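import Summits.QuantumFields.YangMills.Theorems.UnitScaleTiltProp7BoxChartTransport
import Summits.QuantumFields.YangMills.Theorems.UnitScaleTiltProp7LatticeCutoffOneFormSupp
import HarnessLib

/-!
# Route `UnitScaleTilt`, crux K1 «MinimiserStabilityRegPr» (stmt-QuantumFields-19200), LANE II «DIVERGENCE RECOVERY AT CURVED `W`» (★★OWNER RULING №23),
# brick [I-7] `h10` (★p1 g19 NAMER WORD №13): THE `H¹` ROW OF THE CUT-OFF TRANSVERSE REMAINDER `ζ_c · r_c` OF A BOX PATCH, READ AT THE MEMBER THROUGH THE BOX CHART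

Cell `ym3-torus` (HUMAN RULING D-0037: YM₃ on T³ is ladder rung R3 — NOT d = 4, NOT infinite volume, NOT a mass gap, NOT the Clay problem), width seat
`ym-ust-20520-w5` (gen 11), pen of [I-7] (px12 g7 ■ hand-over; split w4-19200 g11 ↔ `h4`, this seat ↔ `h10`, 2026-08-29 09:31Z).  THEOREMS ONLY (0 `def`,
0 `sorry`); `--supports stmt-QuantumFields-19200 --as helper`, count-neutral.  Nothing here claims (REC), `hN06`, a stub, the crux or the gap.

THE POINT.  ★p1 g19's ✓`Prop7DivRecoveryAssemblyBudget.patch_budget` consumes, per patch, the row `h10 : Hρ ≤ CW·(Cu + e²·Φ + K + R⁻²·ρ)` where `Hρ = H(ζ·r)`,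
`H f := c₀ℓ²·CURL_HS(f) + ‖D*_W f‖²` is the local `H¹` energy of LANE II ((QH1)'s functional), `r` is the transverse remainder of the box patch's local Coulomb
potential ((B8-member): `r = 1_{inside}·(y − ∇_Vφ_Z)` along the chart, `D*_W y = Δ_Wφ + κs`, `κs = η⁻¹R(u)⁻¹m` on the interior `Q_{R−1}`), and `ζ` is a real cutoff
(`|ζ| ≤ 1`, bond oscillation `δ`) supported on the chart image of the interior box `Q_{R−1}(z)`.  This file proves that row AT THE MEMBER, in the letters of
✓(T-box) `Prop7BoxChartTransport` §5 and of (B8-member)'s conjuncts, taken as DISPLAYED hypotheses (S1)(S2)(D)(hloc)(L1) on the data `y φ κs r φ_Z m`: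
★★★ `cutoffH1_member` — `c₀ℓ²·CURL_HS(ζ·r) + ‖D*_W(ζ·r)‖² ≤ 24·Cu + 48d²·ℓ⁴α²·‖φ‖² + 4·K + 16d·ℓ²δ²·‖r‖²`, with `Cu := c₀ℓ²·Σ_{w ∈ Q_R(z)}Σ_{μ<ν}‖curl_W y (transl c w)‖_F²`
the local `CURL_HS` of `y` over the chart box and `K := c₀·Σ_{Q_{R−1}}‖η⁻¹R(u)⁻¹m‖_F²` (B8-member)'s source letter ((h3)'s left side).  At the member geometry's data
(`α = 2eη²`, `δ = (3∕2)(L^s·ℓ)⁻¹` from ✓`Prop7Lane2CutoffPackage.exists_cutoffPackage`, `ℓη = 1`, `d = 3`) this is `h10` with `CW = 1728`.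
The `ℤᵈ` half — (B1″) sharpened by the support of the cutoff (so that the divergence of the inside-restricted remainder is read on `Q_{R−1}` where (L1) pins it,
never on the boundary layer of the chart) and the curl of the remainder on the interior box — is the sibling ✓`Prop7LatticeCutoffOneFormSupp`.
HONEST SCOPE.  Bookkeeping over ✓(B1″), ✓(T-box) §1–§5 and the sibling; the (B8-member) rows and the plaquette datum `hP` are DISPLAYED hypotheses (discharged by
px12's ⧗p711072 `boxLocalPotential_member` and by `RegPr` in the member geometry file [I-9]); nothing of (REC)∕hN06∕the crux is proved; YM₃ on T³ is rung R3, not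
d = 4, not Clay; the YM mass gap is NOT proved.

References: T. Bałaban, CMP 99 (1985) 389–434 [Balaban1985BackgroundPropagators] ((3.3), (3.8), (3.10)–(3.11) pp.391–392, (3.23) p.394, (3.100) p.413); CMP 99 (1985)
75–102 [Balaban1985RegularSpaces] ((1.1)–(1.2) p.76); CMP 98 (1985) 17–51 [Balaban1985Averaging] ((18)–(20) p.21, pp.24–25); M. Giaquinta, *Multiple integrals in the
calculus of variations and nonlinear elliptic systems* (1983) [Giaquinta1984] (Ch. III §1–§2).
-/

set_option autoImplicit false

noncomputable section

open scoped BigOperators Matrix.Norms.L2Operator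
open Finset

namespace Summit.QuantumFields.YangMills.Theorems.Prop7BoxLocalPotentialCutoffH1

open Literature.MathematicalPhysics.QuantumFieldTheory.Balaban1983to89
open Literature.MathematicalPhysics.QuantumFieldTheory.Balaban1983to89.T3ContinuumYM3Torus
open Literature.MathematicalPhysics.QuantumFieldTheory.Balaban1983to89.B4Eq19LatticeOperators (Zd box mem_box unitVec box_mono add_unitVec_mem_box
  sub_unitVec_mem_box)
open B10Eq27TorusAxialLog (transl unitsField toUField unitsField_mem_unitaryUnits)
open B9TorusCalculus (torusT)
open B9Eq39Adjoint (curl divB)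
open B7Eq78Linearization (conjR conjR_apply conjR_sub conjR_smul)
open B7Prop1Explicit (U1 axialFn)
open B7Prop2Explicit (unitaryUnits)
open B8Ineq132 (norm_conjR)
open T3SectALandauChart (eta eta_pos covDerivFwdT covDivFormT bgUnits)
open B11Eq103H1Complex (SiteL2K BondL2K)
open Summit.QuantumFields.YangMills.Theorems.Prop7SectET3Transport (periodsT3)
open Summit.QuantumFields.YangMills.Theorems.Prop7SectET3HilbertLetters (W₂ frobEquiv toL2 toL2S DL2 DstarL2 covLapSite)
open Summit.QuantumFields.YangMills.Theorems.Prop7LandauDict (DstarL2_toL2_eq_covDivFormT)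
open Summit.QuantumFields.YangMills.Theorems.Prop7DivSliceOfMemberDivSq (covDivFormT_eta_eq_smul_divB)
open Summit.QuantumFields.YangMills.Theorems.Prop7RieszTauFrobNorm (sum_norm_sq_le_two_mul_opNorm_sq)
open Summit.QuantumFields.YangMills.Theorems.Prop7LatticeBoxPotentialAlgebra (mem_U1_of_mem_unitaryUnits)
open Summit.QuantumFields.YangMills.Theorems.Prop7LatticeCutoffOneFormSupp (cutoff_curl_div_le_supp sum_normSq_curl_defect_le sum_sum_eq_two_mul_sum_lt
  frob_real_smul h10_arith)
open Summit.QuantumFields.YangMills.Theorems.PoincareLipschitzCovariantBridge (transl_add_unitVec transl_sub_unitVec)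
open Summit.QuantumFields.YangMills.Theorems.Prop7BoxChartTransport

/-! ## §1 Near points off the box are not chart points of the interior box -/

/-- **NEAR POINTS OFF THE BOX ARE NOT CHART POINTS OF THE INTERIOR BOX**: for `2R + 1 ≤ N`, `w ∈ Q_{R+1}(z) ∖ Q_R(z)` and `w' ∈ Q_{R−1}(z)` have
`transl c w' ≠ transl c w` (a coordinate differs by an integer in `[2, 2R] ⊂ (0, N)`). [folklore] [cite: Balaban1985BackgroundPropagators, (3.100) p.413] -/
theorem transl_ne_of_off_box {P : Params} {j : ℕ} (c : Site P j) {z : Zd P.d} {R : ℤ} (hRN : 2 * R + 1 ≤ (P.sitesPerDir j : ℤ))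
    {w : Zd P.d} (hw : w ∉ box z R) (hw1 : w ∈ box z (R + 1)) :
    ∀ w' ∈ box z (R - 1), transl c w' ≠ transl c w := by
  intro w' hw' heq
  rw [transl_eq_transl_iff] at heq
  rw [mem_box] at hw hw1 hw'
  obtain ⟨i, hi⟩ := not_forall.mp hw
  have hi : R < |w i - z i| := not_le.mp hi
  have h1 := hw1 i
  have h2 := hw' i
  have hlt : |w i - w' i| < (P.sitesPerDir j : ℤ) := by
    calc |w i - w' i| = |(w i - z i) - (w' i - z i)| := by ring_nf
      _ ≤ |w i - z i| + |w' i - z i| := abs_sub _ _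
      _ ≤ (R + 1) + (R - 1) := add_le_add h1 h2
      _ < _ := by linarith
  have h0 := Int.eq_zero_of_abs_lt_dvd (heq i) hlt
  have hww : w i = w' i := by linarith
  rw [hww] at hi
  linarith

/-! ## §2 ★★★ The H¹ row `h10` of the cut-off transverse remainder, read at the member through the box chart -/

section Member

variable (F : T3Family) (n K : ℕ) (c₀ : ℝ) [Fact (0 < c₀)]

/-- ★★★ **[I-7] `h10` AT THE MEMBER — THE `H¹` ROW OF `ζ·r`.**  Member `F` at heights `n, K` (`ℓ = L^{K−n}`, `η = eta F n K = ℓ⁻¹`), background `W`, centre `c`,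
box `Q_R(z)` charted injectively (`2R + 1 ≤ N`; no lower bound on `R` is needed), pull-back connection `V w μ = W♮⟨transl c w, μ⟩` with plaquette datum `hP` (DISPLAYED), and the data
of (B8-member) ⧗p711072 `boxLocalPotential_member` taken as DISPLAYED hypotheses on `y φ κs r φ_Z m`: (S1) `φ = η•φ_Z` along the chart, `0` off it;
(S2) `r = 1_{inside}·(y − ∇_Vφ_Z)` along the chart bonds, `0` off them; (D) `D_Wφ = ∇_Vφ_Z` on inside bonds; (hloc) `D*_W y = Δ_Wφ + κs`;
(L1) `κs = η⁻¹R(u)⁻¹m` on the interior `Q_{R−1}`.  For a real cutoff `ζ` with `|ζ| ≤ 1`, bond oscillation `|ζ(x⁺μ) − ζ(x)| ≤ δ`, supported on the chart image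
of `Q_{R−1}(z)`, and `Zr` the cut-off remainder (`(toL2)⁻¹Zr = ζ(b₋)·(toL2)⁻¹r`, i.e. px11's `Zb_c r`):
`c₀ℓ²·CURL_HS(Zr) + ‖D*_W Zr‖² ≤ 24·Cu + 48d²·ℓ⁴α²·‖φ‖² + 4·K + 16d·ℓ²δ²·‖r‖²`,
`Cu := c₀ℓ²·Σ_{w∈Q_R}Σ_{μ<ν}‖curl_W y (transl c w)‖_F²` (local `CURL_HS` of `y` over the chart box), `K := c₀Σ_{Q_{R−1}}‖η⁻¹R(u)⁻¹m‖_F²` ((B8-member) (h3)'s left side).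
At `α = 2eη²`, `δ = (3∕2)(L^s·ℓ)⁻¹`, `d = 3` this is ★p1's `patch_budget` row `h10 : Hρ ≤ CW·(Cu + e²Φ + K + R⁻²ρ)` with `CW = 1728`.
Proof: (T-box) §5 box readings ∘ Frobenius ≤ 2·op² ∘ the sibling's `cutoff_curl_div_le_supp` (support `Q_{R−1}`) ∘ `sum_normSq_curl_defect_le` ∘ the interior identity
`div_V g = R(u)⁻¹m` on `Q_{R−1}` from (hloc)+(D)+(L1) ∘ (T-box) `norm_toL2_sq_le_ge_box`∕`norm_sq_toL2S_eq_sum_box`.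
[cite: Balaban1985BackgroundPropagators, (3.8), (3.10)-(3.11) p.392, (3.23) p.394, (3.100) p.413; Balaban1985RegularSpaces, (1.1)-(1.2) p.76; Giaquinta1984, Ch. III §1-§2] -/
theorem cutoffH1_member (W : GaugeField (F.P K) 0 (Matrix.specialUnitaryGroup (Fin 2) ℂ)) (c : Site (F.P K) 0)
    {z : Zd (F.P K).d} {R : ℤ} (hRN : 2 * R + 1 ≤ ((F.P K).sitesPerDir 0 : ℤ))
    (V : Zd (F.P K).d → Fin (F.P K).d → (Matrix (Fin 2) (Fin 2) ℂ)ˣ) (hV : ∀ w μ, V w μ = unitsField (toUField W) ⟨transl c w, μ⟩)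
    {α : ℝ} (hα : 0 ≤ α) (hP : B8Lemma1NonAbelian.PlaqSmall V (fun i => z i - R) (fun i => z i + R) α)
    (y : BondL2K ℂ 3 (periodsT3 F K) c₀ W₂) (φ κs : SiteL2K ℂ 3 (periodsT3 F K) c₀ W₂) (r : BondL2K ℂ 3 (periodsT3 F K) c₀ W₂)
    (φZ : Zd (F.P K).d → Matrix (Fin 2) (Fin 2) ℂ) (m : Matrix (Fin 2) (Fin 2) ℂ)
    (hS1a : ∀ x, (∀ w ∈ box z R, transl c w ≠ x) → (toL2S F K c₀).symm φ x = 0)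
    (hS1b : ∀ w ∈ box z R, (toL2S F K c₀).symm φ (transl c w) = (eta F n K) • φZ w)
    (hS2a : ∀ b : PBond (F.P K) 0, (∀ w ∈ box z R, transl c w ≠ b.src) → (toL2 F K c₀).symm r b = 0)
    (hS2b : ∀ w ∈ box z R, ∀ μ, (toL2 F K c₀).symm r ⟨transl c w, μ⟩
        = if w + unitVec μ ∈ box z R then (toL2 F K c₀).symm y ⟨transl c w, μ⟩ - (conjR (V w μ) (φZ (w + unitVec μ)) - φZ w) else 0)
    (hD : ∀ w ∈ box z R, ∀ μ, w + unitVec μ ∈ box z R →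
        (toL2 F K c₀).symm (DL2 F n K c₀ W φ) ⟨transl c w, μ⟩ = conjR (V w μ) (φZ (w + unitVec μ)) - φZ w)
    (hloc : DstarL2 F n K c₀ W y = covLapSite F n K c₀ W φ + κs)
    (hL1 : ∀ w ∈ box z (R - 1), (toL2S F K c₀).symm κs (transl c w) = (eta F n K)⁻¹ • conjR (axialFn V (fun i => z i - R) w)⁻¹ m)
    (ζ : Site (F.P K) 0 → ℝ) {δ : ℝ} (hζ1 : ∀ x, |ζ x| ≤ 1) (hζδ : ∀ (x : Site (F.P K) 0) (μ : Fin (F.P K).d), |ζ (x.shift μ) - ζ x| ≤ δ)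
    (hζs : ∀ x, (∀ w ∈ box z (R - 1), transl c w ≠ x) → ζ x = 0)
    (Zr : BondL2K ℂ 3 (periodsT3 F K) c₀ W₂) (hZr : ∀ b, (toL2 F K c₀).symm Zr b = ζ b.src • (toL2 F K c₀).symm r b) :
    c₀ * ((F.L : ℝ) ^ (K - n)) ^ 2 * (∑ x : Site (F.P K) 0, ∑ μ : Fin (F.P K).d, ∑ ν' : Fin (F.P K).d,
        (if μ < ν' then ∑ j : Fin 2, ∑ k : Fin 2,
          ‖(curl (torusT (F.P K) 0) (fun κ x => unitsField (toUField W) ⟨x, κ⟩) (fun κ x => (toL2 F K c₀).symm Zr ⟨x, κ⟩) μ ν' x) j k‖ ^ 2 else 0))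
      + ‖DstarL2 F n K c₀ W Zr‖ ^ 2
      ≤ 24 * (c₀ * ((F.L : ℝ) ^ (K - n)) ^ 2 * ∑ w ∈ box z R, ∑ μ : Fin (F.P K).d, ∑ ν' : Fin (F.P K).d,
            (if μ < ν' then ∑ j : Fin 2, ∑ k : Fin 2,
              ‖(curl (torusT (F.P K) 0) (fun κ x => unitsField (toUField W) ⟨x, κ⟩) (fun κ x => (toL2 F K c₀).symm y ⟨x, κ⟩) μ ν' (transl c w)) j k‖ ^ 2
            else 0))
        + 48 * ((F.P K).d : ℝ) ^ 2 * ((F.L : ℝ) ^ (K - n)) ^ 4 * α ^ 2 * ‖φ‖ ^ 2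
        + 4 * (c₀ * ∑ w ∈ box z (R - 1), ∑ j : Fin 2, ∑ k : Fin 2, ‖((eta F n K)⁻¹ • conjR (axialFn V (fun i => z i - R) w)⁻¹ m) j k‖ ^ 2)
        + 16 * ((F.P K).d : ℝ) * ((F.L : ℝ) ^ (K - n)) ^ 2 * δ ^ 2 * ‖r‖ ^ 2 := by
  classical
  -- ### letters
  have hc₀ : 0 < c₀ := Fact.out
  have hL0 : (0 : ℝ) < F.L := by have := F.hL.2; exact_mod_cast (by omega : 0 < F.L)
  set ℓ : ℝ := (F.L : ℝ) ^ (K - n) with hℓdef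
  have hℓ0 : 0 < ℓ := pow_pos hL0 _
  have hη0 : 0 < eta F n K := eta_pos F n K
  have hηℓ : (eta F n K)⁻¹ = ℓ := by rw [hℓdef, T3SectALandauChart.eta, ← inv_pow, inv_inv]
  have hηℓ1 : eta F n K * ℓ = 1 := by rw [← hηℓ, mul_inv_cancel₀ hη0.ne']
  have hd0 : (0 : ℝ) ≤ ((F.P K).d : ℝ) := Nat.cast_nonneg _
  have hVU : ∀ w μ, V w μ ∈ U1 (Matrix (Fin 2) (Fin 2) ℂ) := fun w μ => by
    rw [hV]; exact mem_U1_of_mem_unitaryUnits (unitsField_mem_unitaryUnits (toUField W) _)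
  have hinj := transl_injOn_box c hRN (z := z)
  -- ### the `ℤᵈ` data
  set Rt : PBond (F.P K) 0 → Matrix (Fin 2) (Fin 2) ℂ := (toL2 F K c₀).symm r with hRt
  set Yt : PBond (F.P K) 0 → Matrix (Fin 2) (Fin 2) ℂ := (toL2 F K c₀).symm y with hYt
  set X : PBond (F.P K) 0 → Matrix (Fin 2) (Fin 2) ℂ := (toL2 F K c₀).symm Zr with hXdef
  set g : Zd (F.P K).d → Fin (F.P K).d → Matrix (Fin 2) (Fin 2) ℂ := fun w μ => if w ∈ box z R then Rt ⟨transl c w, μ⟩ else 0 with hg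
  set Y : Zd (F.P K).d → Fin (F.P K).d → Matrix (Fin 2) (Fin 2) ℂ := fun w μ => Yt ⟨transl c w, μ⟩ with hY
  set ζZ : Zd (F.P K).d → ℝ := fun w => if w ∈ box z R then ζ (transl c w) else 0 with hζZ
  have hr_eq : r = toL2 F K c₀ Rt := by rw [hRt, LinearEquiv.apply_symm_apply]
  have hy_eq : y = toL2 F K c₀ Yt := by rw [hYt, LinearEquiv.apply_symm_apply]
  have hZr_eq : Zr = toL2 F K c₀ X := by rw [hXdef, LinearEquiv.apply_symm_apply]
  have hφ_eq : φ = toL2S F K c₀ ((toL2S F K c₀).symm φ) := by rw [LinearEquiv.apply_symm_apply]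
  -- ### geometry of the chart: boundary layer and near points
  have hbdry : ∀ w ∈ box z R, w ∉ box z (R - 1) → ∀ w' ∈ box z (R - 1), transl c w' ≠ transl c w := by
    intro w hw hw' w' hw'1 heq
    have hmem : w' ∈ box z R := box_mono z (by linarith) hw'1
    have := hinj (Finset.mem_coe.mpr hmem) (Finset.mem_coe.mpr hw) heq
    exact hw' (this ▸ hw'1)
  have hζ0 : ∀ w ∈ box z (R + 1), w ∉ box z (R - 1) → ζ (transl c w) = 0 := by
    intro w hw1 hw'
    by_cases hw : w ∈ box z R
    · exact hζs _ (hbdry w hw hw')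
    · exact hζs _ (transl_ne_of_off_box c hRN hw hw1)
  have hR1 : ∀ w ∈ box z R, w ∈ box z (R + 1) := fun w hw => box_mono z (by linarith) hw
  have hRm1 : ∀ w ∈ box z (R - 1), w ∈ box z R := fun w hw => box_mono z (by linarith) hw
  -- ### the three cutoff rows on `ℤᵈ`
  have hζZ1 : ∀ w, |ζZ w| ≤ 1 := by
    intro w; simp only [hζZ]
    split_ifs
    · exact hζ1 _
    · simp
  have hζZs : ∀ w ∉ box z (R - 1), ζZ w = 0 := by
    intro w hw; simp only [hζZ]
    split_ifs with h
    · exact hζ0 w (hR1 w h) hw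
    · rfl
  have hζZδ : ∀ (w : Zd (F.P K).d) (μ : Fin (F.P K).d), |ζZ (w + unitVec μ) - ζZ w| ≤ δ := by
    intro w μ
    have hδ0 : 0 ≤ δ := (abs_nonneg _).trans (hζδ c μ)
    by_cases hw : w ∈ box z R <;> by_cases hwμ : w + unitVec μ ∈ box z R
    · simp only [hζZ, if_pos hw, if_pos hwμ, transl_add_unitVec]; exact hζδ _ μ
    · have hw' : w ∉ box z (R - 1) := fun h => hwμ (by have := add_unitVec_mem_box h μ; rwa [sub_add_cancel] at this)
      have hz1 : ζZ (w + unitVec μ) = 0 := by simp only [hζZ, if_neg hwμ]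
      have hz2 : ζZ w = 0 := by simp only [hζZ, if_pos hw]; exact hζ0 w (hR1 w hw) hw'
      rw [hz1, hz2, sub_zero, abs_zero]; exact hδ0
    · have hwμ' : w + unitVec μ ∉ box z (R - 1) := fun h => hw (by
        have := sub_unitVec_mem_box h μ; rwa [add_sub_cancel_right, sub_add_cancel] at this)
      have hz1 : ζZ (w + unitVec μ) = 0 := by simp only [hζZ, if_pos hwμ]; exact hζ0 (w + unitVec μ) (hR1 _ hwμ) hwμ'
      have hz2 : ζZ w = 0 := by simp only [hζZ, if_neg hw]
      rw [hz1, hz2, sub_zero, abs_zero]; exact hδ0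
    · have hz1 : ζZ (w + unitVec μ) = 0 := by simp only [hζZ, if_neg hwμ]
      have hz2 : ζZ w = 0 := by simp only [hζZ, if_neg hw]
      rw [hz1, hz2, sub_zero, abs_zero]; exact hδ0
  -- ### the remainder on `ℤᵈ`
  have hgoff : ∀ (w : Zd (F.P K).d) (μ : Fin (F.P K).d), (w ∉ box z R ∨ w + unitVec μ ∉ box z R) → g w μ = 0 := by
    intro w μ h
    by_cases hw : w ∈ box z R
    · have h' : w + unitVec μ ∉ box z R := h.resolve_left (not_not.mpr hw)
      simp only [hg, if_pos hw]
      rw [hS2b w hw μ, if_neg h']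
    · simp only [hg, if_neg hw]
  have hgin : ∀ w ∈ box z R, ∀ μ : Fin (F.P K).d, w + unitVec μ ∈ box z R →
      g w μ = (fun (w : Zd (F.P K).d) (μ : Fin (F.P K).d) => Yt ⟨transl c w, μ⟩) w μ - (conjR (V w μ) (φZ (w + unitVec μ)) - φZ w) := by
    intro w hw μ hwμ
    simp only [hg, if_pos hw]
    rw [hS2b w hw μ, if_pos hwμ]
  have hgbox : ∀ w ∈ box z R, ∀ μ : Fin (F.P K).d, g w μ = Rt ⟨transl c w, μ⟩ := fun w hw μ => by simp only [hg, if_pos hw]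
  -- ### the cut-off remainder at chart points
  have hX0 : ∀ b : PBond (F.P K) 0, (∀ w ∈ box z (R - 1), transl c w ≠ b.src) → X b = 0 := by
    intro b hb
    rw [hZr b, hζs _ hb, zero_smul]
  have hXpt : ∀ w ∈ box z (R + 1), ∀ κ : Fin (F.P K).d, X ⟨transl c w, κ⟩ = ((ζZ w : ℝ) : ℂ) • g w κ := by
    intro w hw1 κ
    rw [Complex.coe_smul, hZr]
    by_cases hw : w ∈ box z R
    · simp only [hζZ, hg, if_pos hw]
    · have hw' : w ∉ box z (R - 1) := fun h => hw (hRm1 w h)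
      have hz : ζ (transl c w) = 0 := hζ0 w hw1 hw'
      simp only [hζZ, hg, if_neg hw, smul_zero]
      show ζ (transl c w) • Rt ⟨transl c w, κ⟩ = 0
      rw [hz, zero_smul]
  -- ### the member's two currencies are box sums over the chart
  have hcurlbox := curlHS_eq_sum_box F K c hRN W X hX0
  have hdivbox := norm_sq_DstarL2_toL2_eq_sum_box F n K c₀ c hRN W X hX0
  rw [hZr_eq, hdivbox, hcurlbox]
  -- ### (a) Frobenius ≤ 2·operator, and the stencils in the `ℤᵈ` letters `V ζZ g`
  have hS1 : (∑ y ∈ box z R, ∑ μ : Fin (F.P K).d, ∑ ν' : Fin (F.P K).d,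
          (if μ < ν' then ∑ j : Fin 2, ∑ k : Fin 2,
            ‖(X ⟨transl c y, μ⟩ + conjR (unitsField (toUField W) ⟨transl c y, μ⟩) (X ⟨transl c (y + unitVec μ), ν'⟩)
                - conjR (unitsField (toUField W) ⟨transl c y, ν'⟩) (X ⟨transl c (y + unitVec ν'), μ⟩) - X ⟨transl c y, ν'⟩) j k‖ ^ 2 else 0))
      ≤ 2 * (∑ y ∈ box z R, ∑ μ, ∑ ν,
          ‖((ζZ y : ℂ) • g y μ) + conjR (V y μ) (((ζZ (y + unitVec μ) : ℝ) : ℂ) • g (y + unitVec μ) ν)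
            - conjR (V y ν) (((ζZ (y + unitVec ν) : ℝ) : ℂ) • g (y + unitVec ν) μ) - ((ζZ y : ℂ) • g y ν)‖ ^ 2) := by
    rw [Finset.mul_sum]
    refine Finset.sum_le_sum fun y hy => ?_
    rw [Finset.mul_sum]
    refine Finset.sum_le_sum fun μ _ => ?_
    rw [Finset.mul_sum]
    refine Finset.sum_le_sum fun ν _ => ?_
    rw [hXpt y (hR1 y hy) μ, hXpt y (hR1 y hy) ν, hXpt (y + unitVec μ) (add_unitVec_mem_box hy μ) ν,
      hXpt (y + unitVec ν) (add_unitVec_mem_box hy ν) μ, ← hV y μ, ← hV y ν]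
    split_ifs
    · exact sum_norm_sq_le_two_mul_opNorm_sq _
    · positivity
  have hS2 : (∑ y ∈ box z R, ∑ j : Fin 2, ∑ k : Fin 2,
          ‖(∑ μ, (conjR (unitsField (toUField W) ⟨transl c (y - unitVec μ), μ⟩)⁻¹ (X ⟨transl c (y - unitVec μ), μ⟩) - X ⟨transl c y, μ⟩)) j k‖ ^ 2)
      ≤ 2 * (∑ y ∈ box z R, ‖∑ μ, (conjR (V (y - unitVec μ) μ)⁻¹ (((ζZ (y - unitVec μ) : ℝ) : ℂ) • g (y - unitVec μ) μ) - (ζZ y : ℂ) • g y μ)‖ ^ 2) := by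
    rw [Finset.mul_sum]
    refine Finset.sum_le_sum fun y hy => ?_
    have hinner : (∑ μ, (conjR (unitsField (toUField W) ⟨transl c (y - unitVec μ), μ⟩)⁻¹ (X ⟨transl c (y - unitVec μ), μ⟩) - X ⟨transl c y, μ⟩))
        = ∑ μ, (conjR (V (y - unitVec μ) μ)⁻¹ (((ζZ (y - unitVec μ) : ℝ) : ℂ) • g (y - unitVec μ) μ) - (ζZ y : ℂ) • g y μ) :=
      Finset.sum_congr rfl fun μ _ => by rw [hXpt _ (sub_unitVec_mem_box hy μ) μ, hXpt y (hR1 y hy) μ, hV]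
    rw [hinner]
    exact sum_norm_sq_le_two_mul_opNorm_sq _
  -- ### (b) the sibling's sharpened (B1″) on the chart box, (c) the curl of the remainder on the interior box
  have hA := cutoff_curl_div_le_supp V hVU ζZ hζZ1 hζZδ hζZs g hgoff
  have hB := sum_normSq_curl_defect_le hα V hVU hP (fun (w : Zd (F.P K).d) (μ : Fin (F.P K).d) => Yt ⟨transl c w, μ⟩) g φZ hgin
  beta_reduce at hB
  -- ### (d) the curl of `y` over the interior box against the member's local `CURL_HS`
  have hCY : (∑ y ∈ box z (R - 1), ∑ μ, ∑ ν, ‖Yt ⟨transl c y, μ⟩ + conjR (V y μ) (Yt ⟨transl c (y + unitVec μ), ν⟩)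
          - conjR (V y ν) (Yt ⟨transl c (y + unitVec ν), μ⟩) - Yt ⟨transl c y, ν⟩‖ ^ 2)
      ≤ 2 * (∑ w ∈ box z R, ∑ μ : Fin (F.P K).d, ∑ ν' : Fin (F.P K).d,
            (if μ < ν' then ∑ j : Fin 2, ∑ k : Fin 2,
              ‖(curl (torusT (F.P K) 0) (fun κ x => unitsField (toUField W) ⟨x, κ⟩) (fun κ x => Yt ⟨x, κ⟩) μ ν' (transl c w)) j k‖ ^ 2
            else 0)) := by
    calc (∑ y ∈ box z (R - 1), ∑ μ, ∑ ν, ‖Yt ⟨transl c y, μ⟩ + conjR (V y μ) (Yt ⟨transl c (y + unitVec μ), ν⟩)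
          - conjR (V y ν) (Yt ⟨transl c (y + unitVec ν), μ⟩) - Yt ⟨transl c y, ν⟩‖ ^ 2)
        ≤ (∑ y ∈ box z R, ∑ μ, ∑ ν, ‖Yt ⟨transl c y, μ⟩ + conjR (V y μ) (Yt ⟨transl c (y + unitVec μ), ν⟩)
          - conjR (V y ν) (Yt ⟨transl c (y + unitVec ν), μ⟩) - Yt ⟨transl c y, ν⟩‖ ^ 2) :=
          Finset.sum_le_sum_of_subset_of_nonneg (box_mono z (by linarith)) fun _ _ _ =>
            Finset.sum_nonneg fun _ _ => Finset.sum_nonneg fun _ _ => by positivity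
      _ = ∑ y ∈ box z R, 2 * ∑ μ, ∑ ν, (if μ < ν then ‖Yt ⟨transl c y, μ⟩ + conjR (V y μ) (Yt ⟨transl c (y + unitVec μ), ν⟩)
          - conjR (V y ν) (Yt ⟨transl c (y + unitVec ν), μ⟩) - Yt ⟨transl c y, ν⟩‖ ^ 2 else 0) := by
          refine Finset.sum_congr rfl fun y _ => sum_sum_eq_two_mul_sum_lt _ (fun μ => ?_) (fun μ ν => ?_)
          · have h0 : Yt ⟨transl c y, μ⟩ + conjR (V y μ) (Yt ⟨transl c (y + unitVec μ), μ⟩)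
                - conjR (V y μ) (Yt ⟨transl c (y + unitVec μ), μ⟩) - Yt ⟨transl c y, μ⟩ = 0 := by abel
            rw [h0, norm_zero, zero_pow two_ne_zero]
          · have hneg : Yt ⟨transl c y, ν⟩ + conjR (V y ν) (Yt ⟨transl c (y + unitVec ν), μ⟩)
                - conjR (V y μ) (Yt ⟨transl c (y + unitVec μ), ν⟩) - Yt ⟨transl c y, μ⟩
                = -(Yt ⟨transl c y, μ⟩ + conjR (V y μ) (Yt ⟨transl c (y + unitVec μ), ν⟩)
                    - conjR (V y ν) (Yt ⟨transl c (y + unitVec ν), μ⟩) - Yt ⟨transl c y, ν⟩) := by abel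
            rw [hneg, norm_neg]
      _ = 2 * ∑ y ∈ box z R, ∑ μ, ∑ ν, (if μ < ν then ‖Yt ⟨transl c y, μ⟩ + conjR (V y μ) (Yt ⟨transl c (y + unitVec μ), ν⟩)
          - conjR (V y ν) (Yt ⟨transl c (y + unitVec ν), μ⟩) - Yt ⟨transl c y, ν⟩‖ ^ 2 else 0) := by rw [← Finset.mul_sum]
      _ ≤ 2 * (∑ w ∈ box z R, ∑ μ : Fin (F.P K).d, ∑ ν' : Fin (F.P K).d,
            (if μ < ν' then ∑ j : Fin 2, ∑ k : Fin 2,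
              ‖(curl (torusT (F.P K) 0) (fun κ x => unitsField (toUField W) ⟨x, κ⟩) (fun κ x => Yt ⟨x, κ⟩) μ ν' (transl c w)) j k‖ ^ 2
            else 0)) := by
          refine mul_le_mul_of_nonneg_left (Finset.sum_le_sum fun y _ => Finset.sum_le_sum fun μ _ =>
            Finset.sum_le_sum fun ν _ => ?_) (by norm_num)
          rw [curl_transl, ← hV, ← hV]
          split_ifs
          · exact MatrixNorms.opNorm_sq_le_sum_norm_sq _
          · exact le_rfl
  -- ### (e) on the interior box the divergence of the remainder IS the source
  set Gt : PBond (F.P K) 0 → Matrix (Fin 2) (Fin 2) ℂ := (toL2 F K c₀).symm (DL2 F n K c₀ W φ) with hGt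
  have hGt_eq : DL2 F n K c₀ W φ = toL2 F K c₀ Gt := by rw [hGt, LinearEquiv.apply_symm_apply]
  have hDs : ∀ (T : PBond (F.P K) 0 → Matrix (Fin 2) (Fin 2) ℂ) (w : Zd (F.P K).d),
      (toL2S F K c₀).symm (DstarL2 F n K c₀ W (toL2 F K c₀ T)) (transl c w)
        = (eta F n K)⁻¹ • ∑ μ, (conjR (unitsField (toUField W) ⟨transl c (w - unitVec μ), μ⟩)⁻¹ (T ⟨transl c (w - unitVec μ), μ⟩) - T ⟨transl c w, μ⟩) :=
    fun T w => by rw [DstarL2_toL2_eq_covDivFormT, covDivFormT_eta_eq_smul_divB, divB_transl]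
  have hdivg : ∀ w ∈ box z (R - 1), (∑ μ, (conjR (V (w - unitVec μ) μ)⁻¹ (g (w - unitVec μ) μ) - g w μ))
      = conjR (axialFn V (fun i => z i - R) w)⁻¹ m := by
    intro w hw
    have hwR : w ∈ box z R := hRm1 w hw
    have hwm : ∀ μ : Fin (F.P K).d, w - unitVec μ ∈ box z R := fun μ => by
      have := sub_unitVec_mem_box hw μ; rwa [sub_add_cancel] at this
    have hwp : ∀ μ : Fin (F.P K).d, w + unitVec μ ∈ box z R := fun μ => by
      have := add_unitVec_mem_box hw μ; rwa [sub_add_cancel] at this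
    have hg1 : ∀ μ : Fin (F.P K).d, g (w - unitVec μ) μ = Yt ⟨transl c (w - unitVec μ), μ⟩ - Gt ⟨transl c (w - unitVec μ), μ⟩ := by
      intro μ
      have hback : w - unitVec μ + unitVec μ ∈ box z R := by rw [sub_add_cancel]; exact hwR
      rw [hgin (w - unitVec μ) (hwm μ) μ hback, hD (w - unitVec μ) (hwm μ) μ hback]
    have hg2 : ∀ μ : Fin (F.P K).d, g w μ = Yt ⟨transl c w, μ⟩ - Gt ⟨transl c w, μ⟩ := by
      intro μ
      rw [hgin w hwR μ (hwp μ), hD w hwR μ (hwp μ)]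
    -- the local equation at the chart site, with the `η⁻¹` cancelled
    have hk := congrArg (fun s => (toL2S F K c₀).symm s (transl c w)) hloc
    simp only [map_add, Pi.add_apply] at hk
    rw [hL1 w hw, hy_eq, show covLapSite F n K c₀ W φ = DstarL2 F n K c₀ W (toL2 F K c₀ Gt) by
      rw [← hGt_eq]; rfl, hDs, hDs, ← smul_add] at hk
    have hk' := smul_right_injective (Matrix (Fin 2) (Fin 2) ℂ) (inv_ne_zero hη0.ne') hk
    simp only [← hV] at hk'
    calc (∑ μ, (conjR (V (w - unitVec μ) μ)⁻¹ (g (w - unitVec μ) μ) - g w μ))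
        = ∑ μ, ((conjR (V (w - unitVec μ) μ)⁻¹ (Yt ⟨transl c (w - unitVec μ), μ⟩) - Yt ⟨transl c w, μ⟩)
            - ((conjR (V (w - unitVec μ) μ)⁻¹ (Gt ⟨transl c (w - unitVec μ), μ⟩)) - Gt ⟨transl c w, μ⟩)) :=
          Finset.sum_congr rfl fun μ _ => by rw [hg1, hg2, conjR_sub]; abel
      _ = conjR (axialFn V (fun i => z i - R) w)⁻¹ m := by rw [Finset.sum_sub_distrib, hk', add_sub_cancel_left]
  have hDG : (∑ y ∈ box z (R - 1), ‖∑ μ, (conjR (V (y - unitVec μ) μ)⁻¹ (g (y - unitVec μ) μ) - g y μ)‖ ^ 2)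
      ≤ (eta F n K) ^ 2 * (∑ w ∈ box z (R - 1), ∑ j : Fin 2, ∑ k : Fin 2, ‖((eta F n K)⁻¹ • conjR (axialFn V (fun i => z i - R) w)⁻¹ m) j k‖ ^ 2) := by
    rw [Finset.mul_sum]
    refine Finset.sum_le_sum fun w hw => ?_
    rw [hdivg w hw, frob_real_smul, ← mul_assoc, ← mul_pow, mul_inv_cancel₀ hη0.ne', one_pow, one_mul]
    exact MatrixNorms.opNorm_sq_le_sum_norm_sq _
  -- ### (f) the mass of the remainder and of the potential in the member's currency
  have hG : c₀ * (∑ y ∈ box z R, ∑ μ, ‖g y μ‖ ^ 2) ≤ ‖r‖ ^ 2 := by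
    have h := (norm_toL2_sq_le_ge_box F K c₀ c hRN Rt hS2a g hgbox).1
    rwa [← hr_eq] at h
  have hφn : ‖φ‖ ^ 2 = c₀ * (eta F n K) ^ 2 * (∑ w ∈ box z R, ∑ j : Fin 2, ∑ k : Fin 2, ‖(φZ w) j k‖ ^ 2) := by
    rw [hφ_eq, norm_sq_toL2S_eq_sum_box F K c₀ c hRN _ hS1a, mul_assoc]
    refine congrArg (fun t : ℝ => c₀ * t) ?_
    rw [Finset.mul_sum]
    exact Finset.sum_congr rfl fun w hw => by rw [hS1b w hw, frob_real_smul]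
  have hPZ : c₀ * (∑ w ∈ box z R, ‖φZ w‖ ^ 2) ≤ ℓ ^ 2 * ‖φ‖ ^ 2 := by
    have h1 : (∑ w ∈ box z R, ‖φZ w‖ ^ 2) ≤ (∑ w ∈ box z R, ∑ j : Fin 2, ∑ k : Fin 2, ‖(φZ w) j k‖ ^ 2) := Finset.sum_le_sum fun w _ => MatrixNorms.opNorm_sq_le_sum_norm_sq _
    have h2 : ℓ ^ 2 * ‖φ‖ ^ 2 = c₀ * (∑ w ∈ box z R, ∑ j : Fin 2, ∑ k : Fin 2, ‖(φZ w) j k‖ ^ 2) := by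
      rw [hφn, ← hηℓ]
      field_simp
    rw [h2]
    exact mul_le_mul_of_nonneg_left h1 hc₀.le
  -- ### (g) assembly
  rw [← hℓdef]
  exact h10_arith hc₀.le hd0 hηℓ1 hS1 hS2 hA hB hCY hDG hG hPZ

end Member

end Summit.QuantumFields.YangMills.Theorems.Prop7BoxLocalPotentialCutoffH1

end
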